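import Summits.AtomisticToContinuum.FouriersLaw.Theorems.BondHeatUncertaintyExtensiveSnapshotIrreversibilityEnergyWindowDilationDuhamel
import Summits.AtomisticToContinuum.FouriersLaw.Theorems.BondHeatUncertaintyExtensiveSnapshotIrreversibilityEnergyWindowScoreOrders

/-!
# Bond heat uncertainty — node «DilationDeparture», part X-1A: the position score dual bound
  (SD₁q) and the density toolbox for departure derivatives in an arbitrary direction

Cell `decomp-a2c`, lens «grading / quantitative ladder», generation 87, part X-1 (first of two
files; the theorems (EBᵈ)/(XBⁿ) and the junctions are in `…EnergyWindowDilationDeparture`).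

* §1 **(SD₁q)** `DensityScoreDualBoundPosition[On I]` — the POSITION twin of the graded score
  dual bound `DensityScoreDualBoundOn` (part U): the text of `densityScoreDualBodyOn` with the
  bath-momentum derivatives `densityDeriv` replaced by the bath-POSITION derivatives
  `densityDerivQ` (`0 ↦ ∂_{x_{q_b}} p(s,·,y)(z)` departure, `1 ↦ ∂_{y_{q_b}} p(s,z,·)(y)` arrival);
  restriction lemmas `densityScoreDualBoundPositionOn_mono`, `densityScoreDualBoundOn_mono`.
* §2 density toolbox in an ARBITRARY departure direction `v`:
  `hasLineDerivAt_integral_mul_density` (`x ↦ ∫ G(y) p(s,x,y) dy` has line derivative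
  `∫ G(y) D_x p(s,·,y)(x)·v dy` for `G ∈ C¹_c` — dominated differentiation; the tree's
  `hasDerivAt_integral_mul_density` (part V) is the case `v = (0,e_b)`), hence
  `partialP_integral_mul_density` / `partialQ_integral_mul_density`: `∂_{p_b}`, `∂_{q_b}` of
  `x ↦ ∫ G p(s,x,·)` ARE the index-`0` score-dual integrands — with NO regularity of `P_s G`
  (the coordinate derivatives of `FouriersLaw.lean` are line derivatives of every function,
  `partialP_eq_lineDeriv`), their CONTINUITY in `x` (`continuous_parametric_integral_of_continuous`
  on `tsupport G`), `pertKernelFun_eq_integral_mul_density` (`P^δ_t h (w) = ∫ h(y) p(t,w,y) dy`),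
  the CEHR (3.4) root bound `rpow_integral_abs_rpow_mul_density_le`
  (`(∫ |G|^r p(t,w,·))^{1/r} ≤ e^{θγ(T_L+T_R)} e^{θH(w)}` for `|G| ≤ e^{θH}`, `rθ < 1/max T`).
* §3 the coefficient bound `exists_bathCoeff_le_exp` (`|p_b|, |∂_{q_b}H| ≤ K_η e^{ηH}` for every
  `η > 0`, from the confining estimates `|p_b| ≤ 1 + H`, `|∂_{q_b}H| ≤ (A + N²B)(1 + H)`) and the
  two-temperature window `twoTemperature_window` (`|δ| < min T (1/θ' − T)` ⟹ `T ± δ/2 > 0`,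
  `θ' < 1/max(T ± δ/2)`).

Only `def`/`theorem` declarations; no proof holes.  References: N. Cuneo, J.-P. Eckmann,
M. Hairer, L. Rey-Bellet, Electron. J. Probab. 23 (2018) no. 55, §3 eq. (3.2)–(3.4); D. Nualart,
*The Malliavin Calculus and Related Topics* (2006), Prop. 2.1.4; J. Norris, Séminaire de
probabilités XX (1986), Thm 3.2.
-/

noncomputable section

namespace Summit.AtomisticToContinuum.FouriersLaw.Theorems.ExtensiveSnapshotIrreversibility.EnergyWindow

open MeasureTheory Filter Topology Real Set Metric
open scoped ENNReal NNReal ContDiff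
open Literature.MathematicalPhysics.KineticTheory.HeatConduction Literature.Probability.Process

variable {N : ℕ}

/-! ## 1. (SD₁q): the position twin of the graded score dual bound -/

/-- Position-direction first derivatives of a density at bath site `b`, as functions of the
arrival point `y`: `0 ↦ ∂_{x_{q_b}} p(s,·,y)(z)` (departure), `1 ↦ ∂_{y_{q_b}} p(s,z,·)(y)`
(arrival). [folklore] -/
def densityDerivQ (p : ℝ → PhaseSpace N → PhaseSpace N → ℝ) (s : ℝ) (b : Fin N)
    (z : PhaseSpace N) : Fin 2 → PhaseSpace N → ℝ :=
  ![fun y => partialQ b (fun x => p s x y) z, fun y => partialQ b (p s z) y]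

/-- Body of the position score dual bound restricted to `i ∈ I` — literally the text of
`densityScoreDualBodyOn` (part U) with `densityDeriv` replaced by `densityDerivQ`. [folklore] -/
def densityScoreDualBodyQOn (I : Set (Fin 2)) (ω₂ lam β γ : ℝ) : Prop :=
  ∀ T : ℝ, 0 < T → ∀ (N : ℕ) (hN : 2 ≤ N), ∀ r ε : ℝ, 1 < r → 0 < ε →
    ∃ δ₀ C : ℝ, 0 < δ₀ ∧ 0 ≤ C ∧ ∀ δ : ℝ, |δ| < δ₀ →
      ∀ p : ℝ → PhaseSpace N → PhaseSpace N → ℝ,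
        IsTransitionDensity ω₂ lam β γ N (T + δ / 2) (T - δ / 2) p →
        ∀ s : ℝ, 1 / 2 ≤ s → s ≤ 1 → ∀ b : Fin N, (b = leftBath N hN ∨ b = rightBath N hN) →
          ∀ z : PhaseSpace N, ∀ G : PhaseSpace N → ℝ, ContDiff ℝ ∞ G → HasCompactSupport G →
            ∀ i ∈ I,
              |∫ y, G y * densityDerivQ p s b z i y| ≤
                (∫ y, |G y| ^ r * p s z y) ^ (1 / r) *
                  (C * Real.exp (ε * (pinnedChain ω₂ lam β γ).hamiltonian N z))

/-- **`DensityScoreDualBoundPositionOn I`** — the position score dual bound restricted to the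
derivative indices in `I`, at all positive chain parameters. [folklore] -/
def DensityScoreDualBoundPositionOn (I : Set (Fin 2)) : Prop :=
  ∀ ω₂ lam β γ : ℝ, 0 < ω₂ → 0 < lam → 0 < β → 0 < γ → densityScoreDualBodyQOn I ω₂ lam β γ

/-- **(SD₁q) `DensityScoreDualBoundPosition`** (OPEN · ATTACKABLE-L · the position twin of (SD₁)):
for positive parameters, `T > 0`, `N ≥ 2`, every `1 < r` and `ε > 0` there are `δ₀ > 0`, `C ≥ 0`
such that uniformly in `|δ| < δ₀`, for every jointly smooth density `p` of the kernels with baths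
`T ± δ/2`, every `s ∈ [½, 1]`, both bath sites `b`, every `z` and every smooth compactly
supported `G`:  `|∫ G(y) ∂_{x_{q_b}}p(s,·,y)(z) dy|, |∫ G(y) ∂_{y_{q_b}}p(s,z,y) dy|
≤ (∫ |G|^r p(s,z,y) dy)^{1/r} C e^{εH(z)}` — the `L^q(P_s(z,dy))` norms (`q = r/(r−1)`) of the
conditioned first-order Bismut / Skorokhod weights in the POSITION direction `e_{q_b}` at the bath
sites.  Skeleton side: the `q_b`-rows of the inverse regularised Gram matrix `(Γ_m + κ)⁻¹`
(covered by (MC∞), full `2N × 2N` matrix) and the position copy (RW₁q) of (RW₁).  Only its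
index-`0` (departure) half is used beneath S3 (part X-1, (XBⁿ)); the index-`1` (arrival) half
serves (XBᶠ) (part X-2).  Why it might fail: the position direction is NOT directly noised — the
first-order weight in direction `e_{q_b}` needs one commutator `[p_b ∂_{q_b}, ·]` more than
`e_{p_b}` (Hörmander bracket of length 2), i.e. the `q_b`-row of `Γ_m⁻¹` scales like `s^{-3}`
near `s = 0` — harmless on the window `s ≥ ½` as typed.
(after Nualart2006, Prop. 2.1.4; Norris1986, Thm 3.2; CuneoEckmannHairerReyBellet2018, Prop. 3.2)
[route leaf · named hypothesis of this cell, NOT filed as a literature fact] -/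
def DensityScoreDualBoundPosition : Prop :=
  DensityScoreDualBoundPositionOn Set.univ

/-- Restriction of the position bound to a sub-index-set. [folklore] -/
theorem densityScoreDualBoundPositionOn_mono {I J : Set (Fin 2)} (hIJ : I ⊆ J)
    (h : DensityScoreDualBoundPositionOn J) : DensityScoreDualBoundPositionOn I := by
  intro ω₂ lam β γ hω hl hβ hγ T hT N hN r ε hr hε
  obtain ⟨δ₀, C, hδ₀, hC, hm⟩ := h ω₂ lam β γ hω hl hβ hγ T hT N hN r ε hr hε
  exact ⟨δ₀, C, hδ₀, hC, fun δ hδ p hp s hs hs1 b hb z G hG hGc i hi =>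
    hm δ hδ p hp s hs hs1 b hb z G hG hGc i (hIJ hi)⟩

/-- The momentum bound by index restricts likewise (the tree's `densityScoreDualBodyOn_mono` at
all parameters). [folklore] -/
theorem densityScoreDualBoundOn_mono {I J : Set (Fin 4)} (hIJ : I ⊆ J)
    (h : DensityScoreDualBoundOn J) : DensityScoreDualBoundOn I :=
  fun ω₂ lam β γ hω hl hβ hγ => densityScoreDualBodyOn_mono hIJ (h ω₂ lam β γ hω hl hβ hγ)

/-! ## 2. Density toolbox: departure derivatives of `x ↦ ∫ G(y) p(s,x,y) dy` in any direction -/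

section Density

variable {ω₂ lam β γ : ℝ} {T_L T_R : ℝ} {p : ℝ → PhaseSpace N → PhaseSpace N → ℝ}

/-- The departure directional derivative `(y, x) ↦ D_x p(s,·,y)(x)·v` is jointly continuous
(joint `C¹` smoothness of the density; the tree's `continuous_fderiv_density_left` is
`v = (0,e_b)`). [folklore] -/
theorem continuous_fderiv_density_left_dir (hp : IsTransitionDensity ω₂ lam β γ N T_L T_R p)
    {s : ℝ} (hs0 : 0 < s) (v : PhaseSpace N) :
    Continuous fun w : PhaseSpace N × PhaseSpace N =>
      fderiv ℝ (fun q => p s q w.1) w.2 v := by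
  have hu : ContDiff ℝ 1 (Function.uncurry
      fun (w : PhaseSpace N × PhaseSpace N) (q : PhaseSpace N) => p s q w.1) :=
    (hp.contDiff_uncurry hs0).comp (contDiff_snd.prodMk (contDiff_fst.comp contDiff_fst))
  exact (hu.fderiv_apply (n := 0) contDiff_snd contDiff_const (by norm_num)).continuous

/-- **The departure derivative under the integral sign, any direction.**  For `G ∈ C¹_c`, a
transition density `p`, `s > 0`, `z` and a direction `v`:  `x ↦ ∫ G(y) p(s,x,y) dy` has the line
derivative `∫ G(y) D_x p(s,·,y)(z)·v dy` at `z` along `v` (Mathlib's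
`hasDerivAt_integral_of_dominated_loc_of_deriv_le`, constant bound on
`tsupport G × B̄(z, ‖v‖)`). [folklore] -/
theorem hasLineDerivAt_integral_mul_density (hp : IsTransitionDensity ω₂ lam β γ N T_L T_R p)
    {s : ℝ} (hs0 : 0 < s) (z v : PhaseSpace N) {G : PhaseSpace N → ℝ} (hG : ContDiff ℝ 1 G)
    (hGc : HasCompactSupport G) :
    HasLineDerivAt ℝ (fun x => ∫ y, G y * p s x y)
      (∫ y, G y * fderiv ℝ (fun q => p s q y) z v) z v := by
  show HasDerivAt (fun c : ℝ => ∫ y, G y * p s (z + c • v) y)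
    (∫ y, G y * fderiv ℝ (fun q => p s q y) z v) 0
  have hDc := continuous_fderiv_density_left_dir hp hs0 v
  have hGc' : Continuous G := hG.continuous
  -- the local constant bound
  obtain ⟨C₁, hC₁⟩ := (hGc.isCompact.prod (isCompact_closedBall z ‖v‖)).exists_bound_of_continuousOn
    ((hGc'.comp continuous_fst).mul hDc).continuousOn
  have hKm : MeasurableSet (tsupport G) := (isClosed_tsupport G).measurableSet
  have hseg : ∀ c : ℝ, c ∈ ball (0 : ℝ) 1 → z + c • v ∈ closedBall z ‖v‖ := by
    intro c hc
    rw [mem_closedBall_iff_norm, add_sub_cancel_left, norm_smul]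
    exact mul_le_of_le_one_left (norm_nonneg _) (mem_ball_zero_iff.1 hc).le
  have hmain := hasDerivAt_integral_of_dominated_loc_of_deriv_le
    (μ := (volume : Measure (PhaseSpace N)))
    (F := fun (c : ℝ) (y : PhaseSpace N) => G y * p s (z + c • v) y)
    (F' := fun (c : ℝ) (y : PhaseSpace N) => G y * fderiv ℝ (fun q => p s q y) (z + c • v) v)
    (x₀ := (0 : ℝ)) (bound := (tsupport G).indicator fun _ => C₁) (ball_mem_nhds (0 : ℝ) one_pos)
    ?_ ?_ ?_ ?_ ?_ ?_
  · simpa only [zero_smul, add_zero] using hmain.2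
  · exact Eventually.of_forall fun c =>
      (hGc'.mul (hp.contDiff_right hs0 _).continuous).aestronglyMeasurable
  · exact (hGc'.mul (hp.contDiff_right hs0 _).continuous).integrable_of_hasCompactSupport
      hGc.mul_right
  · exact (hGc'.mul (hDc.comp (continuous_id.prodMk continuous_const))).aestronglyMeasurable
  · refine ae_of_all _ fun y c hc => ?_
    by_cases hy : y ∈ tsupport G
    · rw [Set.indicator_of_mem hy]
      exact hC₁ (y, _) ⟨hy, hseg c hc⟩
    · rw [Set.indicator_of_notMem hy, image_eq_zero_of_notMem_tsupport hy, zero_mul, norm_zero]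
  · rw [integrable_indicator_iff hKm]
    exact integrableOn_const (hGc.isCompact.measure_lt_top).ne
  · refine ae_of_all _ fun y c _ => ?_
    have hpath : HasDerivAt (fun c : ℝ => z + c • v) v c := by
      simpa using ((hasDerivAt_id c).smul_const v).const_add z
    exact ((((hp.contDiff_left hs0 y).differentiable one_ne_zero) _).hasFDerivAt.comp_hasDerivAt
      c hpath).const_mul (G y)

/-- **Continuity of the differentiated integral** `x ↦ ∫ G(y) D_x p(s,·,y)(x)·v dy` for continuous
compactly supported `G` (a parametric integral of a jointly continuous integrand over the compact
`tsupport G`). [folklore] -/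
theorem continuous_integral_mul_fderiv_density (hp : IsTransitionDensity ω₂ lam β γ N T_L T_R p)
    {s : ℝ} (hs0 : 0 < s) (v : PhaseSpace N) {G : PhaseSpace N → ℝ} (hG : Continuous G)
    (hGc : HasCompactSupport G) :
    Continuous fun x : PhaseSpace N => ∫ y, G y * fderiv ℝ (fun q => p s q y) x v := by
  have heq : (fun x : PhaseSpace N => ∫ y, G y * fderiv ℝ (fun q => p s q y) x v) =
      fun x => ∫ y in tsupport G, G y * fderiv ℝ (fun q => p s q y) x v := by
    funext x
    exact (setIntegral_eq_integral_of_forall_compl_eq_zero fun y hy => by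
      rw [image_eq_zero_of_notMem_tsupport hy, zero_mul]).symm
  rw [heq]
  exact continuous_parametric_integral_of_continuous
    (f := fun (x : PhaseSpace N) (y : PhaseSpace N) => G y * fderiv ℝ (fun q => p s q y) x v)
    ((hG.comp continuous_snd).mul
      ((continuous_fderiv_density_left_dir hp hs0 v).comp (continuous_snd.prodMk continuous_fst)))
    hGc.isCompact

/-- `∂_{p_b}` of `x ↦ ∫ G(y) p(s,x,y) dy` at `z` is the index-`0` integrand of (SD₁):
`∫ G(y) ∂_{x_{p_b}}p(s,·,y)(z) dy` — for `G ∈ C¹_c`, WITHOUT any regularity of `x ↦ ∫ G p(s,x,·)`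
(the coordinate derivative is a line derivative for every function). [folklore] -/
theorem partialP_integral_mul_density (hp : IsTransitionDensity ω₂ lam β γ N T_L T_R p) {s : ℝ}
    (hs0 : 0 < s) (b : Fin N) (z : PhaseSpace N) {G : PhaseSpace N → ℝ} (hG : ContDiff ℝ 1 G)
    (hGc : HasCompactSupport G) :
    partialP b (fun x => ∫ y, G y * p s x y) z = ∫ y, G y * densityDeriv p s b z 0 y := by
  rw [partialP_eq_lineDeriv,
    (hasLineDerivAt_integral_mul_density hp hs0 z ((0 : Fin N → ℝ), Pi.single b 1) hG
      hGc).lineDeriv]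
  refine integral_congr_ae (ae_of_all _ fun y => ?_)
  change _ = G y * partialP b (fun x => p s x y) z
  rw [partialP_eq_fderiv ((hp.contDiff_left hs0 y).differentiable one_ne_zero) b]

/-- `∂_{q_b}` of `x ↦ ∫ G(y) p(s,x,y) dy` at `z` is the index-`0` integrand of (SD₁q):
`∫ G(y) ∂_{x_{q_b}}p(s,·,y)(z) dy`. [folklore] -/
theorem partialQ_integral_mul_density (hp : IsTransitionDensity ω₂ lam β γ N T_L T_R p) {s : ℝ}
    (hs0 : 0 < s) (b : Fin N) (z : PhaseSpace N) {G : PhaseSpace N → ℝ} (hG : ContDiff ℝ 1 G)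
    (hGc : HasCompactSupport G) :
    partialQ b (fun x => ∫ y, G y * p s x y) z = ∫ y, G y * densityDerivQ p s b z 0 y := by
  rw [partialQ_eq_lineDeriv,
    (hasLineDerivAt_integral_mul_density hp hs0 z ((Pi.single b 1, 0) : PhaseSpace N) hG
      hGc).lineDeriv]
  refine integral_congr_ae (ae_of_all _ fun y => ?_)
  change _ = G y * partialQ b (fun x => p s x y) z
  rw [partialQ_eq_fderiv ((hp.contDiff_left hs0 y).differentiable one_ne_zero) b]

/-- `x ↦ ∂_{p_b}(∫ G(y) p(s,x,y) dy)` is continuous (`G ∈ C¹_c`). [folklore] -/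
theorem continuous_partialP_integral_mul_density (hp : IsTransitionDensity ω₂ lam β γ N T_L T_R p)
    {s : ℝ} (hs0 : 0 < s) (b : Fin N) {G : PhaseSpace N → ℝ} (hG : ContDiff ℝ 1 G)
    (hGc : HasCompactSupport G) :
    Continuous fun x => partialP b (fun x => ∫ y, G y * p s x y) x := by
  have e : (fun x => partialP b (fun x => ∫ y, G y * p s x y) x) = fun x =>
      ∫ y, G y * fderiv ℝ (fun q => p s q y) x ((0 : Fin N → ℝ), Pi.single b 1) := by
    funext x
    rw [partialP_eq_lineDeriv,
      (hasLineDerivAt_integral_mul_density hp hs0 x ((0 : Fin N → ℝ), Pi.single b 1) hG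
        hGc).lineDeriv]
  rw [e]
  exact continuous_integral_mul_fderiv_density hp hs0 _ hG.continuous hGc

/-- `x ↦ ∂_{q_b}(∫ G(y) p(s,x,y) dy)` is continuous (`G ∈ C¹_c`). [folklore] -/
theorem continuous_partialQ_integral_mul_density (hp : IsTransitionDensity ω₂ lam β γ N T_L T_R p)
    {s : ℝ} (hs0 : 0 < s) (b : Fin N) {G : PhaseSpace N → ℝ} (hG : ContDiff ℝ 1 G)
    (hGc : HasCompactSupport G) :
    Continuous fun x => partialQ b (fun x => ∫ y, G y * p s x y) x := by
  have e : (fun x => partialQ b (fun x => ∫ y, G y * p s x y) x) = fun x =>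
      ∫ y, G y * fderiv ℝ (fun q => p s q y) x ((Pi.single b 1, 0) : PhaseSpace N) := by
    funext x
    rw [partialQ_eq_lineDeriv,
      (hasLineDerivAt_integral_mul_density hp hs0 x ((Pi.single b 1, 0) : PhaseSpace N) hG
        hGc).lineDeriv]
  rw [e]
  exact continuous_integral_mul_fderiv_density hp hs0 _ hG.continuous hGc

/-- **`P^δ_t h(w) = ∫ h(y) p(t,w,y) dy`** for a transition density `p` of the `δ`-chain and
`t > 0` (`IsTransitionDensity.kernel_eq`). [folklore] -/
theorem pertKernelFun_eq_integral_mul_density {T δ : ℝ}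
    (hp : IsTransitionDensity ω₂ lam β γ N (T + δ / 2) (T - δ / 2) p) {t : ℝ} (ht : 0 < t)
    (h : PhaseSpace N → ℝ) :
    pertKernelFun ω₂ lam β γ T δ N h t = fun w => ∫ y, h y * p t w y := by
  funext w
  simp only [pertKernelFun, pertKernel]
  rw [hp.kernel_eq ht w, integral_withDensity_ofReal_phaseSpace
    (hp.contDiff_right ht w).continuous.measurable (hp.2.1 t ht w)]
  exact integral_congr_ae (ae_of_all _ fun y => mul_comm _ _)

/-- **CEHR (3.4) root bound**: for a transition density `p` (baths `T_L, T_R > 0`), `0 < t ≤ 1`,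
`|G| ≤ e^{θH}`, `1 < r`, `rθ < 1/max(T_L,T_R)`:
`(∫ |G(y)|^r p(t,w,y) dy)^{1/r} ≤ e^{θγ(T_L+T_R)} e^{θH(w)}`.
[cite: CuneoEckmannHairerReyBellet2018, §3 eq. (3.4)] -/
theorem rpow_integral_abs_rpow_mul_density_le (hω : 0 < ω₂) (hl : 0 < lam) (hβ : 0 < β)
    (hγ : 0 < γ) (hN0 : 0 < N) (hL : 0 < T_L) (hR : 0 < T_R) {θ r : ℝ} (hθ : 0 < θ) (hr : 1 < r)
    (hθr : r * θ < 1 / max T_L T_R) (hp : IsTransitionDensity ω₂ lam β γ N T_L T_R p) {t : ℝ}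
    (ht0 : 0 < t) (ht1 : t ≤ 1) (w : PhaseSpace N) {G : PhaseSpace N → ℝ}
    (hG : ∀ y, |G y| ≤ Real.exp (θ * (pinnedChain ω₂ lam β γ).hamiltonian N y)) :
    (∫ y, |G y| ^ r * p t w y) ^ (1 / r) ≤
      Real.exp (θ * γ * (T_L + T_R)) * Real.exp (θ * (pinnedChain ω₂ lam β γ).hamiltonian N w) := by
  set H := (pinnedChain ω₂ lam β γ).hamiltonian N with hH
  have hr0 : 0 < r := one_pos.trans hr
  have hϑ0 : 0 < r * θ := mul_pos hr0 hθ
  set μ := (pinnedChain ω₂ lam β γ).transitionKernel N T_L T_R t.toNNReal w with hμ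
  have hk : μ = volume.withDensity fun y => ENNReal.ofReal (p t w y) := hp.kernel_eq ht0 w
  have hpm : Measurable (p t w) := (hp.contDiff_right ht0 w).continuous.measurable
  have hp0 : ∀ y, 0 ≤ p t w y := hp.2.1 t ht0 w
  have hHc : Continuous H := pinnedChain_continuous_hamiltonian ω₂ lam β γ N
  have hEm : Measurable fun y => Real.exp ((r * θ) * H y) :=
    (continuous_const.mul hHc).rexp.measurable
  have hpow : ∀ y, Real.exp (θ * H y) ^ r = Real.exp ((r * θ) * H y) := fun y => by
    rw [← Real.exp_mul]; ring_nf
  obtain ⟨hwi, hwb⟩ := integrable_and_abs_integral_transitionKernel_le hω hl hβ hγ hN0 hL hR hϑ0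
    hθr t.toNNReal w zero_le_one hEm (fun y => by rw [one_mul, abs_of_pos (Real.exp_pos _)])
  simp only [one_mul, Real.coe_toNNReal _ ht0.le] at hwb
  have hwb' : ∫ y, Real.exp ((r * θ) * H y) ∂μ ≤
      Real.exp ((r * θ) * γ * (T_L + T_R)) * Real.exp ((r * θ) * H w) := by
    refine (le_abs_self _).trans (hwb.trans (mul_le_mul_of_nonneg_right ?_ (Real.exp_pos _).le))
    exact Real.exp_le_exp.2 (mul_le_of_le_one_right (by positivity) ht1)
  have h1 : ∫ y, |G y| ^ r * p t w y = ∫ y, |G y| ^ r ∂μ := by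
    rw [hk, integral_withDensity_ofReal_phaseSpace hpm hp0]
    exact integral_congr_ae (ae_of_all _ fun y => mul_comm _ _)
  have h2 : ∫ y, |G y| ^ r ∂μ ≤ ∫ y, Real.exp ((r * θ) * H y) ∂μ :=
    integral_mono_of_nonneg (ae_of_all _ fun y => Real.rpow_nonneg (abs_nonneg _) _) hwi
      (ae_of_all _ fun y => (Real.rpow_le_rpow (abs_nonneg _) (hG y) hr0.le).trans_eq (hpow y))
  have h0 : 0 ≤ ∫ y, |G y| ^ r ∂μ := integral_nonneg fun y => Real.rpow_nonneg (abs_nonneg _) _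
  rw [h1]
  refine (Real.rpow_le_rpow h0 (h2.trans hwb') (by positivity)).trans (le_of_eq ?_)
  rw [← Real.exp_add, ← Real.exp_add, ← Real.exp_mul]
  congr 1
  field_simp

end Density

/-! ## 3. Coefficient growth and the two-temperature window -/

/-- **The bath-exchange coefficients grow sub-exponentially**: for the confining pinned chain
(`ω₂ > 0`, `lam, β, γ ≥ 0`) and every `η > 0` there is `K ≥ 0` with `|p_b| ≤ K e^{ηH}` and
`|∂_{q_b} H| ≤ K e^{ηH}` at every site (`|p_b| ≤ 1 + H`, `|∂_{q_b}H| ≤ (A + N²B)(1 + H)` from the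
Literature's `abs_dPotential_le`, and `1 + H ≤ (1 + η⁻¹) e^{ηH}`). [folklore] -/
theorem exists_bathCoeff_le_exp {ω₂ lam β γ : ℝ} (hω : 0 < ω₂) (hl : 0 ≤ lam) (hβ : 0 ≤ β)
    (hγ : 0 ≤ γ) (N : ℕ) {η : ℝ} (hη : 0 < η) :
    ∃ K : ℝ, 0 ≤ K ∧ ∀ (b : Fin N) (w : PhaseSpace N),
      |w.2 b| ≤ K * Real.exp (η * (pinnedChain ω₂ lam β γ).hamiltonian N w) ∧
        |partialQ b ((pinnedChain ω₂ lam β γ).hamiltonian N) w| ≤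
          K * Real.exp (η * (pinnedChain ω₂ lam β γ).hamiltonian N w) := by
  set P := pinnedChain ω₂ lam β γ with hP
  have hconf : P.IsConfining := SubdiffusiveBondHeat.pinnedChain_isConfining hω hl hβ hγ
  obtain ⟨A, hA0, hA⟩ := hconf.exists_abs_deriv_U_le
  obtain ⟨B, hB0, hB⟩ := hconf.exists_abs_deriv_V_le
  refine ⟨(1 + (A + N ^ 2 * B)) * (1 + η⁻¹), by positivity, fun b w => ?_⟩
  set Hw := P.hamiltonian N w with hHw
  have hH0 : 0 ≤ Hw := pinnedChain_hamiltonian_nonneg hω.le hl hβ γ N w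
  -- `1 + H ≤ (1 + η⁻¹) e^{ηH}`
  have hexp : 1 + Hw ≤ (1 + η⁻¹) * Real.exp (η * Hw) := by
    have h1 : 1 ≤ Real.exp (η * Hw) := Real.one_le_exp (by positivity)
    have h2 : η * Hw + 1 ≤ Real.exp (η * Hw) := Real.add_one_le_exp _
    have h3 : Hw ≤ η⁻¹ * Real.exp (η * Hw) := by
      rw [le_inv_mul_iff₀ hη]; linarith
    have h4 : (1 + η⁻¹) * Real.exp (η * Hw) = Real.exp (η * Hw) + η⁻¹ * Real.exp (η * Hw) := by
      ring
    linarith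
  have hE0 : 0 ≤ (1 + η⁻¹) * Real.exp (η * Hw) := by positivity
  have hmom : |w.2 b| ≤ 1 + Hw :=
    LinearResponseFTUR.abs_momentum_le_one_add hconf.U_nonneg hconf.V_nonneg w b
  have hfor : |partialQ b (P.hamiltonian N) w| ≤ (A + N ^ 2 * B) * (1 + Hw) :=
    LinearResponseFTUR.abs_partialQ_hamiltonian_le hconf.U_nonneg hconf.V_nonneg hA0 hB0 hA hB
      hconf.differentiable_U hconf.differentiable_V w b
  have hAB : 0 ≤ A + N ^ 2 * B := by positivity
  constructor
  · calc |w.2 b| ≤ 1 * ((1 + η⁻¹) * Real.exp (η * Hw)) := by rw [one_mul]; exact hmom.trans hexp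
      _ ≤ (1 + (A + N ^ 2 * B)) * (1 + η⁻¹) * Real.exp (η * Hw) := by
          rw [mul_assoc]
          exact mul_le_mul_of_nonneg_right (by linarith) hE0
  · calc |partialQ b (P.hamiltonian N) w| ≤ (A + N ^ 2 * B) * ((1 + η⁻¹) * Real.exp (η * Hw)) :=
          hfor.trans (mul_le_mul_of_nonneg_left hexp hAB)
      _ ≤ (1 + (A + N ^ 2 * B)) * (1 + η⁻¹) * Real.exp (η * Hw) := by
          rw [mul_assoc]
          exact mul_le_mul_of_nonneg_right (by linarith) hE0

/-- Temperature bookkeeping: for `0 < θ'`, `θ' T < 1` and `|δ| < min T (1/θ' − T)` both bath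
temperatures `T ± δ/2` are positive and `θ' < 1/max(T + δ/2, T − δ/2)`. [folklore] -/
theorem twoTemperature_window {T θ' δ : ℝ} (hT : 0 < T) (hθ'0 : 0 < θ') (hθ'1 : θ' < 1 / T)
    (hδ : |δ| < min T (1 / θ' - T)) :
    0 < T + δ / 2 ∧ 0 < T - δ / 2 ∧ θ' < 1 / max (T + δ / 2) (T - δ / 2) := by
  have hTθ : θ' * T < 1 := by rwa [lt_div_iff₀ hT] at hθ'1
  have hδT : |δ| < T := lt_of_lt_of_le hδ (min_le_left _ _)
  have hδg : |δ| < 1 / θ' - T := lt_of_lt_of_le hδ (min_le_right _ _)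
  obtain ⟨⟨hδ1, hδ2⟩, hδ3, hδ4⟩ := And.intro (abs_lt.1 hδT) (abs_lt.1 hδg)
  have hL : 0 < T + δ / 2 := by linarith
  have hR : 0 < T - δ / 2 := by linarith
  have hm0 : 0 < max (T + δ / 2) (T - δ / 2) := lt_max_iff.2 (Or.inl hL)
  have hm : max (T + δ / 2) (T - δ / 2) < 1 / θ' := max_lt (by linarith) (by linarith)
  refine ⟨hL, hR, ?_⟩
  rw [lt_div_iff₀ hm0]
  calc θ' * max (T + δ / 2) (T - δ / 2) < θ' * (1 / θ') := mul_lt_mul_of_pos_left hm hθ'0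
    _ = 1 := mul_one_div_cancel hθ'0.ne'

end Summit.AtomisticToContinuum.FouriersLaw.Theorems.ExtensiveSnapshotIrreversibility.EnergyWindow

end
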